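import Literature.AlgebraicGeometry.Motives.AbelianVarietyBaseChangeTower
import HarnessLib

/-!
# The tower isomorphism `(A ⊗_k k′) ⊗_{k′} S ≅ A ⊗_k S` commutes with the projections to `A`

Companion to `Motives/AbelianVarietyBaseChangeTower` (`AbelianVariety.baseChangeTowerIso`, transitivity of base change,
Görtz–Wedhorn I Prop. 4.16 / §(4.7)): on underlying schemes the isomorphism `e_A : (A ⊗_k k′) ⊗_{k′} S → A ⊗_k S` satisfies
`e_A ≫ pr_A = pr_{A ⊗ k′} ≫ pr_A` — it is «the» canonical identification of fibre products `(X ×_S S′) ×_{S′} S″ = X ×_S S″`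
(Görtz–Wedhorn (4.8): «the functors `(u ∘ u′)^*` and `(u′)^* ∘ u^*` from `C/S` to `C/S″` are isomorphic», the isomorphism being
the one compatible with the projections).  Needed wherever a point or a morphism into `A ⊗_k S` built through the tower is read
back on `A` (e.g. reading `σ • x` on `A(S)` for a descent `A₂ ≅ A ⊗_k k′` given over `k′`).

* §1 (Mathlib `Over` bookkeeping) `overPullbackCongr_hom_app_left_comp_fst`, `pullbackComp_inv_app_left_comp_fst` (the component
  of Mathlib's `Over.pullbackComp f g : pullback (f ≫ g) ≅ pullback g ⋙ pullback f` commutes with the projections — from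
  `conjugateEquiv_counit`), `pullbackComp_symm_trans_congr_hom_app_left_comp_fst`.
* §2 `AbelianVariety.toSchemeHom_baseChangeTowerIso_hom` (the scheme map of `baseChangeTowerIso` is the component of
  `bcFunctorTowerIso`), **`AbelianVariety.toSchemeHom_baseChangeTowerIso_hom_comp_fst`** (`e_A ≫ pr_A = pr ≫ pr`).

All proved; no definition, no named fact.  Kernel note: the component is rewritten along `bcFunctorTowerIso = … ≪≫ …` (an `rfl`
equation) BEFORE it is evaluated at an object — asking the kernel to unfold `bcFunctorTowerIso` under `.hom.app` directly does not
terminate in reasonable time.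

## References
* [GortzWedhorn2020] U. Görtz, T. Wedhorn, *Algebraic Geometry I* (2nd ed. 2020), Prop. 4.16, §(4.7)–(4.8).
* [MumfordAV1970] D. Mumford, *Abelian Varieties* (1970), §19 (p. 176).
-/

noncomputable section

open CategoryTheory CategoryTheory.Limits AlgebraicGeometry

universe u

namespace Literature.AlgebraicGeometry.Motives

/-! ## §1 Components of the `Over.pullback` isomorphisms against the first projection -/

/-- The isomorphism `Over.pullback f ≅ Over.pullback g` induced by an equality `f = g` (`overPullbackCongr`) commutes with the
first projections: `(e.app Z) ≫ pr = pr`. [cite: GortzWedhorn2020, §(4.7)] -/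
theorem overPullbackCongr_hom_app_left_comp_fst {X Y : Scheme.{u}} {f g : X ⟶ Y} (h : f = g) (Z : Over Y) :
    ((overPullbackCongr h).hom.app Z).left ≫ pullback.fst Z.hom g = pullback.fst Z.hom f := by
  subst h
  rw [show overPullbackCongr (rfl : f = f) = Iso.refl _ from rfl]
  simp

/-- The component of Mathlib's `Over.pullbackComp f g : pullback (f ≫ g) ≅ pullback g ⋙ pullback f` (inverse direction) commutes
with the projections: `e⁻¹_W ≫ pr_W = pr ≫ pr_W` — the transposed conjugation identity `conjugateEquiv_counit` for the adjunctions
`Over.map ⊣ Over.pullback`, read on underlying objects. [cite: GortzWedhorn2020, Prop. 4.16 and §(4.8)] -/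
theorem pullbackComp_inv_app_left_comp_fst {X Y Z : Scheme.{u}} (f : X ⟶ Y) (g : Y ⟶ Z) (W : Over Z) :
    ((Over.pullbackComp f g).inv.app W).left ≫ pullback.fst W.hom (f ≫ g) =
      pullback.fst ((Over.pullback g).obj W).hom f ≫ pullback.fst W.hom g := by
  have h := conjugateEquiv_counit ((Over.mapPullbackAdj f).comp (Over.mapPullbackAdj g)) (Over.mapPullbackAdj (f ≫ g))
    (Over.mapComp f g).hom W
  have h' := congrArg CommaMorphism.left h
  simp only [Over.comp_left, Over.map_map_left,
    Over.mapPullbackAdj_counit_app, Adjunction.comp_counit_app, Over.mapComp_hom_app_left, Over.homMk_left] at h'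
  exact h'

/-- `((pullbackComp f g)⁻¹ ≪≫ (pullback (f ≫ g) ≅ pullback fg))_W ≫ pr_W = pr ≫ pr_W` for `f ≫ g = fg` — the shape of
`AbelianVariety.bcFunctorTowerIso`. [cite: GortzWedhorn2020, Prop. 4.16 and §(4.8)] -/
theorem pullbackComp_symm_trans_congr_hom_app_left_comp_fst {X Y Z : Scheme.{u}} {f : X ⟶ Y} {g : Y ⟶ Z}
    {fg : X ⟶ Z} (h : f ≫ g = fg) (W : Over Z) :
    (((Over.pullbackComp f g).symm ≪≫ overPullbackCongr h).hom.app W).left ≫ pullback.fst W.hom fg =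
      pullback.fst ((Over.pullback g).obj W).hom f ≫ pullback.fst W.hom g := by
  subst h
  rw [show overPullbackCongr (rfl : f ≫ g = f ≫ g) = Iso.refl _ from rfl, Iso.trans_refl]
  exact pullbackComp_inv_app_left_comp_fst f g W

/-! ## §2 The tower isomorphism of abelian varieties against the projections -/

namespace AbelianVariety

variable (k k' S : Type u) [Field k] [Field k'] [Field S] [Algebra k k'] [Algebra k' S] [Algebra k S]
  [IsScalarTower k k' S]

/-- On underlying schemes, `baseChangeTowerIso k k′ S A` IS the component of `bcFunctorTowerIso k k′ S` at `A` (the group-object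
wrappers `Functor.mapGrpCompIso`, `Functor.mapGrpNatIso` do not change the underlying morphism).
[cite: GortzWedhorn2020, Prop. 4.16 and Remark 16.54] -/
theorem toSchemeHom_baseChangeTowerIso_hom (A : AbelianVariety k) :
    Hom.toSchemeHom (baseChangeTowerIso k k' S A).hom = ((bcFunctorTowerIso k k' S).hom.app A.X).left := by
  simp [baseChangeTowerIso, baseChangeTowerGrpNatIso, Hom.toSchemeHom]
  exact Category.id_comp _

/-- **`e_A ≫ pr_A = pr_{A ⊗ k′} ≫ pr_A`**: the tower isomorphism `(A ⊗_k k′) ⊗_{k′} S ≅ A ⊗_k S` (transitivity of base change,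
Görtz–Wedhorn I Prop. 4.16 / §(4.8)) commutes with the projections onto `A`. [cite: GortzWedhorn2020, Prop. 4.16 and §(4.8)]
[cite: MumfordAV1970, §19 (p. 176)] -/
theorem toSchemeHom_baseChangeTowerIso_hom_comp_fst (A : AbelianVariety k) :
    Hom.toSchemeHom (baseChangeTowerIso k k' S A).hom ≫ pullback.fst A.X.hom (bcSpec k S) =
      pullback.fst (A.baseChange k').X.hom (bcSpec k' S) ≫ pullback.fst A.X.hom (bcSpec k k') := by
  rw [toSchemeHom_baseChangeTowerIso_hom,
    show bcFunctorTowerIso k k' S = (Over.pullbackComp (bcSpec k' S) (bcSpec k k')).symm ≪≫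
      overPullbackCongr (bcSpec_comp_bcSpec_of_isScalarTower k k' S) from rfl]
  exact pullbackComp_symm_trans_congr_hom_app_left_comp_fst (bcSpec_comp_bcSpec_of_isScalarTower k k' S) A.X

end AbelianVariety

end Literature.AlgebraicGeometry.Motives

end
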